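import Mathlib.Analysis.SpecificLimits.Normed
import Mathlib.Analysis.Normed.Group.InfiniteSum
import Mathlib.Topology.Algebra.InfiniteSum.NatInt
import Mathlib.Topology.Algebra.InfiniteSum.Real
import HarnessLib

/-!
# Tail and truncation bounds for `ℤ`-indexed series with geometrically decaying, interval-enclosed terms

HONEST FRAMING: exact (Metropolis-corrected) sampling algorithms for lattice gauge theory;
figures of merit are autocorrelation/cost numbers at stated couplings and volumes; no
continuum-physics claim.

Venture `LatticeQCDFlow` (cell pub-lqcd), sub-topic `Scoring`; FANOUT row 5 (`s0-sun-a`), GEN-14.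
NEW WORK of the cell (placement rule).  The kernel-checked enclosures of the topological
susceptibility `χ_t = 1/12 + M/(4π²Z)` (`Scoring/U1TorusTopologicalSusceptibilityTwelfth.lean`) evaluate
double series `Σ_{n∈ℤ} r_{|n|}^k Σ_{m∈ℤ} r_{|m|} c(n+m)` in the Bessel ratios `r_k = I_k(β)/I₀(β)`,
which are enclosed for `k ≤ M` by `Scoring/BesselIRatioLadder.lean` and decay geometrically beyond:
`r_{k+1} ≤ θ r_k` for `k ≥ M`, `θ = β/(2(M+1)) < 1`.  This file is the ABSTRACT real analysis of the
truncation, for any sequence `r : ℕ → ℝ` with `0 ≤ r_k ≤ 1`, `a_k ≤ r_k ≤ b_k` (`k ≤ M`), the decay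
beyond `M` and `Σ_{m∈ℤ} r_{|m|} < ∞`:

* `tsum_int_tail_le` — `Σ_{|m|>M} r_{|m|} ≤ 2 b_M θ/(1−θ)` (=: `2T`);
* `tsum_int_eq_sum_range_add_tail` — `Σ_{m∈ℤ} g(m) = Σ_{i<2M+1} g(i−M) + Σ_{|m|>M} g(m)`;
* **`abs_tsum_sub_truncation_le`** — for `|c| ≤ 1`:
  `|Σ_m r_{|m|} c(m) − Σ_{i<2M+1} a_{|i−M|} c(i−M)| ≤ (2M+1)ε + 2T` (`b_k − a_k ≤ ε`);
* **`abs_tsum_le_bound`** — `|Σ_m r_{|m|} c(m)| ≤ Σ_{i<2M+1} b_{|i−M|} + 2T`;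
* **`tsum_pow_mem`** — `Σ_{i<2M+1} a_{|i−M|}^V ≤ Σ_m r_{|m|}^V ≤ Σ_{i<2M+1} b_{|i−M|}^V + 2T` (`V ≥ 1`);
* **`abs_tsum_sub_sum_le_of_abs_le`** — `|Σ_m G(m) − Σ_{i<2M+1} G(i−M)| ≤ C·2T` when `|G(m)| ≤ C r_{|m|}`.

Elementary (geometric series, `tsum_of_nat_of_neg_add_one`); nothing is cited.
-/

noncomputable section

open Real Finset Filter Topology

namespace Summit.Ventures.LatticeQCDFlow.Scoring

variable {r a b : ℕ → ℝ} {M : ℕ} {θ : ℝ}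

/-- `|Σ' f| ≤ Σ' |f|` for a summable real series over `ℤ`. -/
theorem abs_tsum_int_le {f : ℤ → ℝ} (hf : Summable f) : |∑' m, f m| ≤ ∑' m, |f m| := by
  have h := norm_tsum_le_tsum_norm (f := f) (by simpa [← Real.norm_eq_abs] using hf.abs)
  simpa only [Real.norm_eq_abs] using h

/-! ### 1. Geometric decay beyond `M` and the tail over `ℕ` -/

/-- `r_{M+j} ≤ r_M θ^j`. -/
theorem le_mul_pow_of_decay (hdec : ∀ k, M ≤ k → r (k + 1) ≤ θ * r k) (hθ : 0 ≤ θ) (j : ℕ) :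
    r (M + j) ≤ r M * θ ^ j := by
  induction j with
  | zero => simp
  | succ j ih =>
    calc r (M + (j + 1)) = r (M + j + 1) := by rw [Nat.add_assoc]
      _ ≤ θ * r (M + j) := hdec _ (by omega)
      _ ≤ θ * (r M * θ ^ j) := mul_le_mul_of_nonneg_left ih hθ
      _ = r M * θ ^ (j + 1) := by ring

/-- The `ℕ`-tail indicator is summable and `Σ_{k>M} r_k ≤ b_M θ/(1−θ)`. -/
theorem tsum_nat_tail_le (h0 : ∀ k, 0 ≤ r k) (hdec : ∀ k, M ≤ k → r (k + 1) ≤ θ * r k)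
    (hθ0 : 0 ≤ θ) (hθ1 : θ < 1) (hbM : r M ≤ b M)
    (hs : Summable fun k : ℕ => if M < k then r k else 0) :
    ∑' k : ℕ, (if M < k then r k else 0) ≤ b M * θ / (1 - θ) := by
  have hbM0 : 0 ≤ b M := (h0 M).trans hbM
  -- compare with the geometric majorant `g k = [M < k] b_M θ^{k-M}`
  set g : ℕ → ℝ := fun k => if M < k then b M * θ ^ (k - M) else 0 with hg
  have hg_shift : ∀ j : ℕ, g (j + (M + 1)) = b M * θ * θ ^ j := fun j => by
    rw [hg]; simp only
    rw [if_pos (by omega), show j + (M + 1) - M = j + 1 by omega, pow_succ]; ring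
  have hgs' : Summable fun j : ℕ => g (j + (M + 1)) := by
    simp_rw [hg_shift]; exact (summable_geometric_of_lt_one hθ0 hθ1).mul_left _
  have hgs : Summable g := (summable_nat_add_iff (M + 1)).1 hgs'
  have hg_sum : ∑' k, g k = b M * θ / (1 - θ) := by
    rw [← hgs.sum_add_tsum_nat_add (M + 1)]
    have hz : ∑ i ∈ range (M + 1), g i = 0 :=
      Finset.sum_eq_zero fun i hi => by rw [hg]; simp only; rw [if_neg (by simp at hi; omega)]
    rw [hz, zero_add]
    simp_rw [hg_shift]
    rw [tsum_mul_left, tsum_geometric_of_lt_one hθ0 hθ1]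
    have : 1 - θ ≠ 0 := by linarith
    field_simp
  rw [← hg_sum]
  refine hs.tsum_le_tsum (fun k => ?_) hgs
  by_cases hk : M < k
  · rw [if_pos hk, hg]; simp only; rw [if_pos hk]
    obtain ⟨j, rfl⟩ : ∃ j, k = M + (j + 1) := ⟨k - M - 1, by omega⟩
    rw [show M + (j + 1) - M = j + 1 by omega]
    exact (le_mul_pow_of_decay hdec hθ0 (j + 1)).trans
      (mul_le_mul_of_nonneg_right hbM (pow_nonneg hθ0 _))
  · rw [if_neg hk, hg]; simp only; rw [if_neg hk]

/-! ### 2. The tail over `ℤ` -/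

/-- Summability of the `ℤ`-tail indicator from `Σ_m r_{|m|} < ∞`. -/
theorem summable_int_tail (h0 : ∀ k, 0 ≤ r k) (hs : Summable fun m : ℤ => r m.natAbs) :
    Summable fun m : ℤ => if M < m.natAbs then r m.natAbs else 0 := by
  refine Summable.of_nonneg_of_le (fun m => ?_) (fun m => ?_) hs
  · split_ifs
    · exact h0 _
    · exact le_rfl
  · split_ifs
    · exact le_rfl
    · exact h0 _

/-- **`Σ_{|m|>M} r_{|m|} ≤ 2 b_M θ/(1−θ)`.** -/
theorem tsum_int_tail_le (h0 : ∀ k, 0 ≤ r k) (hdec : ∀ k, M ≤ k → r (k + 1) ≤ θ * r k)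
    (hθ0 : 0 ≤ θ) (hθ1 : θ < 1) (hbM : r M ≤ b M) (hs : Summable fun m : ℤ => r m.natAbs) :
    ∑' m : ℤ, (if M < m.natAbs then r m.natAbs else 0) ≤ 2 * (b M * θ / (1 - θ)) := by
  set t : ℤ → ℝ := fun m => if M < m.natAbs then r m.natAbs else 0 with ht
  have hts : Summable t := summable_int_tail h0 hs
  have h1 : Summable fun n : ℕ => t n := hts.comp_injective Nat.cast_injective
  have h2 : Summable fun n : ℕ => t (-(n + 1)) :=
    hts.comp_injective (f := t) (i := fun n : ℕ => -((n : ℤ) + 1)) fun a b hab => by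
      simp only [neg_inj, add_left_inj, Nat.cast_inj] at hab; exact hab
  rw [tsum_of_nat_of_neg_add_one h1 h2]
  have e1 : (fun n : ℕ => t n) = fun k : ℕ => if M < k then r k else 0 := by
    funext k; rw [ht]; simp only [Int.natAbs_natCast]
  have e2 : (fun n : ℕ => t (-(n + 1))) = fun k : ℕ => if M < k + 1 then r (k + 1) else 0 := by
    funext k; rw [ht]; simp only
    rw [show (-((k : ℤ) + 1)).natAbs = k + 1 by omega]
  rw [e1, e2]
  have hsN : Summable fun k : ℕ => if M < k then r k else 0 := by rw [← e1]; exact h1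
  have hA := tsum_nat_tail_le h0 hdec hθ0 hθ1 hbM hsN
  -- the shifted tail is bounded by the unshifted one
  have hB : ∑' k : ℕ, (if M < k + 1 then r (k + 1) else 0) ≤ ∑' k : ℕ, (if M < k then r k else 0) := by
    rw [← hsN.sum_add_tsum_nat_add 1]
    have hnn : 0 ≤ ∑ i ∈ range 1, (if M < i then r i else 0) :=
      Finset.sum_nonneg fun i _ => by split_ifs; exacts [h0 _, le_rfl]
    linarith
  linarith

/-! ### 3. Splitting a `ℤ`-series at `|m| ≤ M` -/

/-- The window `|m| ≤ M` as the image of `range (2M+1)` under `i ↦ i − M`. -/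
theorem mem_image_range_sub_iff (m : ℤ) :
    m ∈ (range (2 * M + 1)).image (fun i : ℕ => (i : ℤ) - M) ↔ m.natAbs ≤ M := by
  simp only [Finset.mem_image, Finset.mem_range]
  constructor
  · rintro ⟨i, hi, rfl⟩; omega
  · intro h; exact ⟨(m + M).toNat, by omega, by omega⟩

/-- **`Σ_{m∈ℤ} g(m) = Σ_{i<2M+1} g(i−M) + Σ_{|m|>M} g(m)`** for summable `g`. -/
theorem tsum_int_eq_sum_range_add_tail {g : ℤ → ℝ} (hg : Summable g) :
    ∑' m : ℤ, g m = ∑ i ∈ range (2 * M + 1), g ((i : ℤ) - M) +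
      ∑' m : ℤ, (if M < m.natAbs then g m else 0) := by
  have hsplit : ∀ m : ℤ, g m = (if m.natAbs ≤ M then g m else 0) + (if M < m.natAbs then g m else 0) := by
    intro m; by_cases h : m.natAbs ≤ M
    · rw [if_pos h, if_neg (not_lt.2 h), add_zero]
    · rw [if_neg h, if_pos (not_le.1 h), zero_add]
  have hs1 : Summable fun m : ℤ => if m.natAbs ≤ M then g m else 0 := by
    refine summable_of_ne_finset_zero (s := (range (2 * M + 1)).image (fun i : ℕ => (i : ℤ) - M))
      fun m hm => ?_
    rw [mem_image_range_sub_iff] at hm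
    rw [if_neg hm]
  have hs2 : Summable fun m : ℤ => if M < m.natAbs then g m else 0 := by
    have := hg.sub hs1
    refine this.congr fun m => ?_
    by_cases h : m.natAbs ≤ M
    · rw [if_pos h, if_neg (not_lt.2 h), sub_self]
    · rw [if_neg h, if_pos (not_le.1 h), sub_zero]
  rw [tsum_congr hsplit, Summable.tsum_add hs1 hs2]
  congr 1
  rw [tsum_eq_sum (s := (range (2 * M + 1)).image (fun i : ℕ => (i : ℤ) - M)) fun m hm => by
    rw [mem_image_range_sub_iff] at hm; rw [if_neg hm]]
  rw [Finset.sum_image fun i _ j _ h => by simpa using h]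
  refine Finset.sum_congr rfl fun i hi => ?_
  rw [if_pos (by simp at hi; omega)]

/-! ### 4. Truncation bounds -/

/-- **Truncation of `Σ_m r_{|m|} c(m)`** against the rational proxy `Σ_{i<2M+1} a_{|i−M|} c(i−M)`:
`|Σ_m r_{|m|} c(m) − Σ_i a_{|i−M|} c(i−M)| ≤ (2M+1) ε + 2 b_M θ/(1−θ)` for `|c| ≤ 1`,
`a_k ≤ r_k ≤ b_k`, `b_k − a_k ≤ ε` (`k ≤ M`). -/
theorem abs_tsum_sub_truncation_le (h0 : ∀ k, 0 ≤ r k)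
    (hdec : ∀ k, M ≤ k → r (k + 1) ≤ θ * r k) (hθ0 : 0 ≤ θ) (hθ1 : θ < 1)
    (hab : ∀ k, k ≤ M → a k ≤ r k ∧ r k ≤ b k) {ε : ℝ} (hε : ∀ k, k ≤ M → b k - a k ≤ ε)
    (hs : Summable fun m : ℤ => r m.natAbs) {c : ℤ → ℝ} (hc : ∀ j, |c j| ≤ 1) :
    |∑' m : ℤ, r m.natAbs * c m - ∑ i ∈ range (2 * M + 1), a ((i : ℤ) - M).natAbs * c ((i : ℤ) - M)| ≤
      (2 * M + 1) * ε + 2 * (b M * θ / (1 - θ)) := by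
  have hsum : Summable fun m : ℤ => r m.natAbs * c m := by
    refine Summable.of_norm_bounded hs fun m => ?_
    rw [Real.norm_eq_abs, abs_mul, abs_of_nonneg (h0 _)]
    exact mul_le_of_le_one_right (h0 _) (hc m)
  rw [tsum_int_eq_sum_range_add_tail (M := M) hsum, add_comm, add_sub_assoc, ← Finset.sum_sub_distrib]
  refine (abs_add_le _ _).trans ?_
  rw [add_comm ((2 * M + 1) * ε)]
  refine add_le_add ?_ ?_
  · -- the tail
    have hts := summable_int_tail (M := M) h0 hs
    have hle : ∀ m : ℤ, |(if M < m.natAbs then r m.natAbs * c m else 0)| ≤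
        (if M < m.natAbs then r m.natAbs else 0) := fun m => by
      split_ifs
      · rw [abs_mul, abs_of_nonneg (h0 _)]; exact mul_le_of_le_one_right (h0 _) (hc m)
      · simp
    have hsumt : Summable fun m : ℤ => (if M < m.natAbs then r m.natAbs * c m else 0) :=
      Summable.of_norm_bounded hts fun m => by rw [Real.norm_eq_abs]; exact hle m
    calc |∑' m : ℤ, (if M < m.natAbs then r m.natAbs * c m else 0)|
        ≤ ∑' m : ℤ, |(if M < m.natAbs then r m.natAbs * c m else 0)| := abs_tsum_int_le hsumt
      _ ≤ ∑' m : ℤ, (if M < m.natAbs then r m.natAbs else 0) := hsumt.abs.tsum_le_tsum hle hts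
      _ ≤ 2 * (b M * θ / (1 - θ)) := tsum_int_tail_le h0 hdec hθ0 hθ1 (hab M le_rfl).2 hs
  · -- the window
    calc |∑ i ∈ range (2 * M + 1), (r ((i : ℤ) - M).natAbs * c ((i : ℤ) - M) -
          a ((i : ℤ) - M).natAbs * c ((i : ℤ) - M))|
        ≤ ∑ i ∈ range (2 * M + 1), |r ((i : ℤ) - M).natAbs * c ((i : ℤ) - M) -
          a ((i : ℤ) - M).natAbs * c ((i : ℤ) - M)| := Finset.abs_sum_le_sum_abs _ _
      _ ≤ ∑ _i ∈ range (2 * M + 1), ε := by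
          refine Finset.sum_le_sum fun i hi => ?_
          have hk : ((i : ℤ) - M).natAbs ≤ M := by simp at hi; omega
          obtain ⟨h1, h2⟩ := hab _ hk
          rw [← sub_mul, abs_mul]
          calc |r ((i : ℤ) - M).natAbs - a ((i : ℤ) - M).natAbs| * |c ((i : ℤ) - M)|
              ≤ (b ((i : ℤ) - M).natAbs - a ((i : ℤ) - M).natAbs) * 1 := by
                refine mul_le_mul ?_ (hc _) (abs_nonneg _) (by linarith)
                rw [abs_of_nonneg (by linarith)]; linarith
            _ ≤ ε := by rw [mul_one]; exact hε _ hk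
      _ = (2 * M + 1) * ε := by rw [Finset.sum_const, Finset.card_range, nsmul_eq_mul]; push_cast; ring

/-- **`|Σ_m r_{|m|} c(m)| ≤ Σ_{i<2M+1} b_{|i−M|} + 2 b_M θ/(1−θ)`** for `|c| ≤ 1`. -/
theorem abs_tsum_le_bound (h0 : ∀ k, 0 ≤ r k)
    (hdec : ∀ k, M ≤ k → r (k + 1) ≤ θ * r k) (hθ0 : 0 ≤ θ) (hθ1 : θ < 1)
    (hab : ∀ k, k ≤ M → a k ≤ r k ∧ r k ≤ b k)
    (hs : Summable fun m : ℤ => r m.natAbs) {c : ℤ → ℝ} (hc : ∀ j, |c j| ≤ 1) :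
    |∑' m : ℤ, r m.natAbs * c m| ≤
      ∑ i ∈ range (2 * M + 1), b ((i : ℤ) - M).natAbs + 2 * (b M * θ / (1 - θ)) := by
  have hsum : Summable fun m : ℤ => r m.natAbs * c m := by
    refine Summable.of_norm_bounded hs fun m => ?_
    rw [Real.norm_eq_abs, abs_mul, abs_of_nonneg (h0 _)]
    exact mul_le_of_le_one_right (h0 _) (hc m)
  have hle : ∀ m : ℤ, |r m.natAbs * c m| ≤ r m.natAbs := fun m => by
    rw [abs_mul, abs_of_nonneg (h0 _)]; exact mul_le_of_le_one_right (h0 _) (hc m)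
  calc |∑' m : ℤ, r m.natAbs * c m| ≤ ∑' m : ℤ, |r m.natAbs * c m| := abs_tsum_int_le hsum
    _ ≤ ∑' m : ℤ, r m.natAbs := hsum.abs.tsum_le_tsum hle hs
    _ = ∑ i ∈ range (2 * M + 1), r ((i : ℤ) - M).natAbs +
          ∑' m : ℤ, (if M < m.natAbs then r m.natAbs else 0) := tsum_int_eq_sum_range_add_tail hs
    _ ≤ ∑ i ∈ range (2 * M + 1), b ((i : ℤ) - M).natAbs + 2 * (b M * θ / (1 - θ)) := by
        refine add_le_add (Finset.sum_le_sum fun i hi => (hab _ (by simp at hi; omega)).2) ?_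
        exact tsum_int_tail_le h0 hdec hθ0 hθ1 (hab M le_rfl).2 hs

/-- **`Σ_m r_{|m|}^V`** between the window sums of `a^V`, `b^V` (plus the tail, using `r^V ≤ r`). -/
theorem tsum_pow_mem (h0 : ∀ k, 0 ≤ r k) (h1 : ∀ k, r k ≤ 1)
    (hdec : ∀ k, M ≤ k → r (k + 1) ≤ θ * r k) (hθ0 : 0 ≤ θ) (hθ1 : θ < 1)
    (hab : ∀ k, k ≤ M → a k ≤ r k ∧ r k ≤ b k) (ha0 : ∀ k, k ≤ M → 0 ≤ a k)
    (hs : Summable fun m : ℤ => r m.natAbs) {V : ℕ} (hV : 1 ≤ V) :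
    ∑ i ∈ range (2 * M + 1), a ((i : ℤ) - M).natAbs ^ V ≤ ∑' m : ℤ, r m.natAbs ^ V ∧
      ∑' m : ℤ, r m.natAbs ^ V ≤
        ∑ i ∈ range (2 * M + 1), b ((i : ℤ) - M).natAbs ^ V + 2 * (b M * θ / (1 - θ)) := by
  have hpow_le : ∀ m : ℤ, r m.natAbs ^ V ≤ r m.natAbs := fun m => by
    obtain ⟨W, rfl⟩ := Nat.exists_eq_add_of_le' hV
    rw [pow_succ]
    exact mul_le_of_le_one_left (h0 _) (pow_le_one₀ (h0 _) (h1 _))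
  have hsum : Summable fun m : ℤ => r m.natAbs ^ V :=
    Summable.of_nonneg_of_le (fun m => pow_nonneg (h0 _) _) hpow_le hs
  rw [tsum_int_eq_sum_range_add_tail (M := M) hsum]
  have htail0 : 0 ≤ ∑' m : ℤ, (if M < m.natAbs then r m.natAbs ^ V else 0) :=
    tsum_nonneg fun m => by split_ifs; exacts [pow_nonneg (h0 _) _, le_rfl]
  have hts := summable_int_tail (M := M) h0 hs
  have htailV : Summable fun m : ℤ => (if M < m.natAbs then r m.natAbs ^ V else 0) :=
    Summable.of_nonneg_of_le (fun m => by split_ifs; exacts [pow_nonneg (h0 _) _, le_rfl])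
      (fun m => by split_ifs; exacts [hpow_le m, le_rfl]) hts
  constructor
  · have : ∑ i ∈ range (2 * M + 1), a ((i : ℤ) - M).natAbs ^ V ≤
        ∑ i ∈ range (2 * M + 1), r ((i : ℤ) - M).natAbs ^ V :=
      Finset.sum_le_sum fun i hi => by
        have hk : ((i : ℤ) - M).natAbs ≤ M := by simp at hi; omega
        exact pow_le_pow_left₀ (ha0 _ hk) (hab _ hk).1 V
    linarith
  · refine add_le_add (Finset.sum_le_sum fun i hi => ?_) ?_
    · have hk : ((i : ℤ) - M).natAbs ≤ M := by simp at hi; omega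
      exact pow_le_pow_left₀ (h0 _) (hab _ hk).2 V
    · exact (htailV.tsum_le_tsum (fun m => by split_ifs; exacts [hpow_le m, le_rfl]) hts).trans
        (tsum_int_tail_le h0 hdec hθ0 hθ1 (hab M le_rfl).2 hs)

/-- **Truncation of a series dominated by `C r_{|m|}`**: if `|G(m)| ≤ C r_{|m|}` for all `m` then
`|Σ_m G(m) − Σ_{i<2M+1} G(i−M)| ≤ C · 2 b_M θ/(1−θ)`. -/
theorem abs_tsum_sub_sum_le_of_abs_le (h0 : ∀ k, 0 ≤ r k)
    (hdec : ∀ k, M ≤ k → r (k + 1) ≤ θ * r k) (hθ0 : 0 ≤ θ) (hθ1 : θ < 1) (hbM : r M ≤ b M)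
    (hs : Summable fun m : ℤ => r m.natAbs) {G : ℤ → ℝ} {C : ℝ} (hC : 0 ≤ C)
    (hG : ∀ m, |G m| ≤ C * r m.natAbs) :
    |∑' m : ℤ, G m - ∑ i ∈ range (2 * M + 1), G ((i : ℤ) - M)| ≤ C * (2 * (b M * θ / (1 - θ))) := by
  have hsum : Summable G :=
    Summable.of_norm_bounded (hs.mul_left C) fun m => by rw [Real.norm_eq_abs]; exact hG m
  rw [tsum_int_eq_sum_range_add_tail (M := M) hsum, add_sub_cancel_left]
  have hts := summable_int_tail (M := M) h0 hs
  have hle : ∀ m : ℤ, |(if M < m.natAbs then G m else 0)| ≤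
      C * (if M < m.natAbs then r m.natAbs else 0) := fun m => by
    split_ifs
    · exact hG m
    · simp
  have hsumt : Summable fun m : ℤ => (if M < m.natAbs then G m else 0) :=
    Summable.of_norm_bounded (hts.mul_left C) fun m => by rw [Real.norm_eq_abs]; exact hle m
  calc |∑' m : ℤ, (if M < m.natAbs then G m else 0)|
      ≤ ∑' m : ℤ, |(if M < m.natAbs then G m else 0)| := abs_tsum_int_le hsumt
    _ ≤ ∑' m : ℤ, C * (if M < m.natAbs then r m.natAbs else 0) :=
        hsumt.abs.tsum_le_tsum hle (hts.mul_left C)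
    _ = C * ∑' m : ℤ, (if M < m.natAbs then r m.natAbs else 0) := tsum_mul_left
    _ ≤ C * (2 * (b M * θ / (1 - θ))) :=
        mul_le_mul_of_nonneg_left (tsum_int_tail_le h0 hdec hθ0 hθ1 hbM hs) hC

end Summit.Ventures.LatticeQCDFlow.Scoring
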